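import Summits.QuantumFields.YangMills.Theorems.BalabanUVNodesN15CurvedGluingCubeDressedGeneralDefect
import HarnessLib

/-!
# Route «BalabanUVNodes» (cluster K4 «SpineRates»), Track-A DAG node N15 = NE2, BACKGROUND LAYER — THE DRESSED CUBE WITH A DECAYING PERTURBATION: EVERY COMPONENT TWO-SIDED LOCALIZED AT BOTH
# GRIDS (FILE 55's `hDG`∕`hIDG` shapes), and the η-defect of the RIGHT entries (`hIGE`)

Cell `pub-ymgap`, seat `pub-ymgap-dag-n15-w3` (WIDTH SEAT 3∕3 on node N15, director-ym №197 ∕ HUMAN RULING D-0149; plan `W-SEAT-START-LIST.md` §n15 item 3 — twenty-fifth piece: the rows of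
files 23–24 that FILE 55 `gluedLetters_of_cubeRows` consumes and that were still one-sided or missing).  `bears_on: R4∕N15 · K3⁷ SpineGivenEndpointR13SepCoPH (stmt-QuantumFields-20544)`.
Filed `--kind proof --supports stmt-QuantumFields-20544 --as helper` — COUNT-NEUTRAL.  Theorems only; 0 `sorry`.  Imports BY NAME file 24 `…N15CurvedGluingCubeDressedGeneralDefect`
(`hasMaj_idef_dressedV_proj`, `idef_out_in`, `hasMaj_sandwichVE`; file 23 `hasMaj_dressedV_pair`, `dressedV_comp_eq_self`, `hasMaj_stepVE`, `isUnit_stepVE`, `hasMaj_bgSourceVE`;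
file 21 `mulOp_eq_zero_of_vanish`; dag-n15-c B1a `bgPropV_fix`∕`bgSourceV`∕`bgSourceV_fix`∕`bgPropV_comp`, B2 `stack`∕`projO`∕`idef_stack`∕`hasMaj_stack`∕`hasMaj_projO_comp`, A2
`idef_source_step_majorant`, FILE 47 `hasMaj_localize`; lit `hasMaj_comp_exp`, `wrow_of_exp`); nothing in the tree is modified.

* §1 ★★ `hasMaj_projO_dressedV_loc₂` (component `j`: `pr_jX̂ ≤ 1_S(y)1_S(y′)·β(1 − q)⁻¹e^{−ρ₂d}` from the flat component's output cut-off and the flat piece's input cut-off),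
  ★★ `hasMaj_idef_projO_dressedV_loc₂` (its η-defect, two-sided: FILE 55's `hIDG` shape);
* §2 `hasMaj_V_bgSourceVE` (`V̂∘Z`), ★★ `hasMaj_idef_bgSourceVE` (the η-defect of the RECTANGULAR SOURCE STEP with a decaying perturbation: B1a `hasMaj_idef_bgSourceV` with decaying
  letters), ★★ `hasMaj_idef_dressedV_comp` (the jet pair's right entries `X̂∘Q`: defect from `𝔇(G₀′Q′, G₀Q), 𝔇(D′_jQ′, D_jQ) ≤ m_Qe^{−δd}` — FILE 55's `hIGE` shape, unlocalized).

HONEST FRAMING ∕ LIMITS.  Finite-dimensional Neumann∕defect bookkeeping over DISPLAYED letters (flat cube entries, right entries, defects, cut-offs at both grids; the perturbation's decay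
and fit letters); nothing of [B9] asserted ((3.42), (3.63)–(3.65), (3.76)–(3.77), Thm 3.14 = SHAPES ∕ MECHANISM ∕ TEMPLATE).  NE2⁺ NOT PRINTED, NOT proved; N15 NOT discharged; counts of
record UNMOVED (typed 28∕28 · discharged 5∕27); one finite 𝕋⁴ at fixed ε — NOT infinite volume, NOT OS on ℝ⁴, NOT a mass gap, NOT Clay; R4 closes the conditional finite-𝕋⁴ rung
`BalabanLadder.UV` only.  Restate-immune (no Theses import).
-/

set_option autoImplicit false

noncomputable section
open scoped BigOperators
open Finset

namespace Summit.QuantumFields.YangMills.BalabanUVNodes.N15.CurvedSpecies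

open Literature.MathematicalPhysics.QuantumFieldTheory.Balaban1983to89
open Literature.MathematicalPhysics.QuantumFieldTheory.Balaban1983to89.B11SectG (BlockNorm HasMaj RowSum hasMaj_comp_exp)
open Literature.MathematicalPhysics.QuantumFieldTheory.Balaban1983to89.B6RandomWalk (Triangle254)
open Literature.MathematicalPhysics.QuantumFieldTheory.Balaban1983to89.B9SectDWeightedNeumann (WRow wrow_of_exp)
open Literature.MathematicalPhysics.QuantumFieldTheory.Balaban1983to89.T4EtaRateDefect (idef idef_apply slowWeight_const)
open Literature.MathematicalPhysics.QuantumFieldTheory.Balaban1983to89.T4EtaRateCoeffDefect (pull pull_apply)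
open Literature.MathematicalPhysics.QuantumFieldTheory.Balaban1983to89.B6Prop26Gluing (mulOp mulOp_apply ind ind_nonneg ind_of_mem)
open Summit.QuantumFields.YangMills.BalabanUVNodes.N15.MatrixSpecies (liftBlk liftMap)
open Summit.QuantumFields.YangMills.BalabanUVNodes.N15.DerivDefect (exists_const_hasMaj_ofBlocks)
open Summit.QuantumFields.YangMills.BalabanUVNodes.N15.BackgroundModel (kappa_ofBlocks)
open Summit.QuantumFields.YangMills.BalabanUVNodes.N15.BackgroundLayer (stack projO blkPair liftPair hasMaj_stack hasMaj_projO_comp idef_stack bgPropV bgPropV_fix bgSourceV bgSourceV_fix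
  bgPropV_comp)
open Summit.QuantumFields.YangMills.BalabanUVNodes.N15.BackgroundStep (idef_source_step_majorant)
open Summit.QuantumFields.YangMills.BalabanUVNodes.N15.Gluing (loc_ofBlocks_eq_zero hasMaj_localize)

/-! ## §1 Every component, two-sided localized at both grids -/

section Components

variable {X X' ι J : Type} [Fintype X] [Fintype X'] [DecidableEq X] [DecidableEq X'] [Fintype ι] [DecidableEq ι] [Fintype J] [DecidableEq J] {g : B6.Geometry}
  (blk : X → g.Site) (π : X' → X) {σ cr : ℝ} {G₀ : (X × ι → ℝ) →ₗ[ℝ] (X × ι → ℝ)} {D Dq : J ⊕ J → (X × ι → ℝ) →ₗ[ℝ] (X × ι → ℝ)}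
  {V : ((X × ι) × Option (J ⊕ J) → ℝ) →ₗ[ℝ] (X × ι → ℝ)} {G₀' : (X' × ι → ℝ) →ₗ[ℝ] (X' × ι → ℝ)} {D' Dq' : J ⊕ J → (X' × ι → ℝ) →ₗ[ℝ] (X' × ι → ℝ)}
  {V' : ((X' × ι) × Option (J ⊕ J) → ℝ) →ₗ[ℝ] (X' × ι → ℝ)}

omit [Fintype X'] [DecidableEq X'] in
/-- the cut-offs of a dressed component: output from the flat component's, input from the flat piece's. [folklore] -/
theorem projO_dressedV_cutoffs (hDq : ∀ j, D j = Dq j ∘ₗ G₀) (hunit : IsUnit (1 - LinearMap.toMatrix' (stack G₀ D ∘ₗ V))) (j : Option (J ⊕ J)) {χ ψ : X × ι → ℝ}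
    (hχ : mulOp χ ∘ₗ (projO j ∘ₗ stack G₀ D) = projO j ∘ₗ stack G₀ D) (hGψ : G₀ ∘ₗ mulOp ψ = G₀) :
    mulOp χ ∘ₗ (projO j ∘ₗ bgPropV (stack G₀ D) V) = projO j ∘ₗ bgPropV (stack G₀ D) V ∧
      (projO j ∘ₗ bgPropV (stack G₀ D) V) ∘ₗ mulOp ψ = projO j ∘ₗ bgPropV (stack G₀ D) V := by
  have hfix := bgPropV_fix hunit
  have hfac : projO j ∘ₗ bgPropV (stack G₀ D) V = (projO j ∘ₗ stack G₀ D) ∘ₗ (LinearMap.id + V ∘ₗ bgPropV (stack G₀ D) V) := by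
    conv_lhs => rw [hfix]
    rw [LinearMap.comp_add, LinearMap.comp_add, LinearMap.comp_id, LinearMap.comp_assoc, LinearMap.comp_assoc]
  refine ⟨?_, ?_⟩
  · rw [hfac, ← LinearMap.comp_assoc, hχ]
  · rw [LinearMap.comp_assoc, dressedV_comp_eq_self (V := V) hDq hGψ]

/-- ★★ **COMPONENT `j`, TWO-SIDED LOCALIZED** (FILE 55's `hG` for `j = none`, `hDG`-type for `j = ±μ`): the flat component's output cut-off `M_{ψ′}∘pr_jŜ = pr_jŜ` and the flat piece's
input cut-off `G₀ = G₀M_ψ` (both over `S`) ⟹ `pr_jX̂ ≤ 1_S(y)1_S(y′)·β(1 − βRc_r²)⁻¹e^{−ρ₂d}`. [cite: Balaban1984PropagatorsII, (2.133) p.247 (shape); Balaban1985BackgroundPropagators, (3.65) p.403 (mechanism)] -/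
theorem hasMaj_projO_dressedV_loc₂ (htri : Triangle254 g) (hd : ∀ a b : g.Site, 0 ≤ g.dist a b) (hrow : RowSum g σ cr) (hσ : 0 ≤ σ) {ρ₁ ρ₂ δ δV β R : ℝ} (hβ : 0 ≤ β)
    (hR : 0 ≤ R) (hcr : 0 ≤ cr) (hσρ : σ ≤ ρ₁) (hρ₁V : ρ₁ ≤ δV) (hρ₁G : ρ₁ + σ ≤ δ) (hρ₂ : 0 ≤ ρ₂) (hρ₂₁ : ρ₂ + σ ≤ ρ₁) (hDq : ∀ j, D j = Dq j ∘ₗ G₀) (j : Option (J ⊕ J))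
    {S : Set g.Site} {ψ'X ψX : X → ℝ} (hSψ' : ∀ x, ψ'X x ≠ 0 → blk x ∈ S) (hSψ : ∀ x, ψX x ≠ 0 → blk x ∈ S)
    (hψ' : mulOp (fun p : X × ι => ψ'X p.1) ∘ₗ (projO j ∘ₗ stack G₀ D) = projO j ∘ₗ stack G₀ D) (hGψ : G₀ ∘ₗ mulOp (fun p : X × ι => ψX p.1) = G₀)
    (hG : HasMaj (BlockNorm.ofBlocks g (liftBlk blk ι)) (BlockNorm.ofBlocks g (liftBlk blk ι)) G₀ (fun y y' => β * Real.exp (-(δ * g.dist y y'))))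
    (hD : ∀ j, HasMaj (BlockNorm.ofBlocks g (liftBlk blk ι)) (BlockNorm.ofBlocks g (liftBlk blk ι)) (D j) (fun y y' => β * Real.exp (-(δ * g.dist y y'))))
    (hV : HasMaj (BlockNorm.ofBlocks g (blkPair (liftBlk blk ι))) (BlockNorm.ofBlocks g (liftBlk blk ι)) V (fun y y' => R * Real.exp (-(δV * g.dist y y'))))
    (hq : β * (R * cr) * cr < 1) :
    HasMaj (BlockNorm.ofBlocks g (liftBlk blk ι)) (BlockNorm.ofBlocks g (liftBlk blk ι)) (projO j ∘ₗ bgPropV (stack G₀ D) V)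
      (fun y y' => ind S y * ind S y' * (β * (1 - β * (R * cr) * cr)⁻¹ * Real.exp (-(ρ₂ * g.dist y y')))) := by
  obtain ⟨hunit, hX⟩ := hasMaj_dressedV_pair blk htri hd hrow hσ hβ hR hcr hσρ hρ₁V hρ₁G hρ₂ hρ₂₁ hG hD hV hq
  have hβX : 0 ≤ β * (1 - β * (R * cr) * cr)⁻¹ := mul_nonneg hβ (inv_nonneg.2 (by linarith))
  obtain ⟨hout, hin⟩ := projO_dressedV_cutoffs hDq hunit j hψ' hGψ
  refine hasMaj_localize (liftBlk blk ι) (liftBlk blk ι) (fun a b => mul_nonneg hβX (Real.exp_nonneg _)) (fun μ p hp => ?_) (fun μ hμ => ?_)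
    (hasMaj_projO_comp (liftBlk blk ι) hX j)
  · have hψ0 : ψ'X p.1 = 0 := by by_contra h; exact hp (hSψ' p.1 h)
    rw [← hout]
    simp only [LinearMap.comp_apply, mulOp_apply, hψ0, zero_mul]
  · rw [← hin, LinearMap.comp_apply, mulOp_eq_zero_of_vanish blk hSψ μ hμ, map_zero]

/-- ★★ **THE η-DEFECT OF COMPONENT `j`, TWO-SIDED LOCALIZED** (FILE 55's `hIG`∕`hIDG` shapes): with the component cut-offs at BOTH grids,
`𝔇(pr_jX̂′, pr_jX̂) ≤ 1_S(y)1_S(y′)·(…)(1 − q)⁻¹e^{−ρ₂d}`. [cite: Balaban1984PropagatorsII, (2.133) p.247 (shape); Balaban1985BackgroundPropagators, Thm 3.14 pp.426–427 (template)] -/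
theorem hasMaj_idef_projO_dressedV_loc₂ (htri : Triangle254 g) (hd : ∀ a b : g.Site, 0 ≤ g.dist a b) (hrow : RowSum g σ cr) (hσ : 0 ≤ σ) (hcr : 0 ≤ cr)
    {ρ₁ ρ₂ δ δV β R o mG : ℝ} (hβ : 0 ≤ β) (hR : 0 ≤ R) (ho : 0 ≤ o) (hmG : 0 ≤ mG) (hσρ : σ ≤ ρ₁) (hρ₁V : ρ₁ ≤ δV) (hρ₁G : ρ₁ + σ ≤ δ) (hρ₂ : 0 ≤ ρ₂) (hρ₂₁ : ρ₂ + σ ≤ ρ₁)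
    (hDq : ∀ j, D j = Dq j ∘ₗ G₀) (hDq' : ∀ j, D' j = Dq' j ∘ₗ G₀') (j : Option (J ⊕ J)) {S : Set g.Site} {ψ'X ψX : X → ℝ} {ψ'X' ψX' : X' → ℝ}
    (hSψ' : ∀ x, ψ'X x ≠ 0 → blk x ∈ S) (hSψ : ∀ x, ψX x ≠ 0 → blk x ∈ S) (hSψ'f : ∀ x', ψ'X' x' ≠ 0 → blk (π x') ∈ S) (hSψf : ∀ x', ψX' x' ≠ 0 → blk (π x') ∈ S)
    (hψ' : mulOp (fun p : X × ι => ψ'X p.1) ∘ₗ (projO j ∘ₗ stack G₀ D) = projO j ∘ₗ stack G₀ D) (hGψ : G₀ ∘ₗ mulOp (fun p : X × ι => ψX p.1) = G₀)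
    (hψ'f : mulOp (fun p : X' × ι => ψ'X' p.1) ∘ₗ (projO j ∘ₗ stack G₀' D') = projO j ∘ₗ stack G₀' D') (hGψf : G₀' ∘ₗ mulOp (fun p : X' × ι => ψX' p.1) = G₀')
    (hG : HasMaj (BlockNorm.ofBlocks g (liftBlk blk ι)) (BlockNorm.ofBlocks g (liftBlk blk ι)) G₀ (fun y y' => β * Real.exp (-(δ * g.dist y y'))))
    (hD : ∀ j, HasMaj (BlockNorm.ofBlocks g (liftBlk blk ι)) (BlockNorm.ofBlocks g (liftBlk blk ι)) (D j) (fun y y' => β * Real.exp (-(δ * g.dist y y'))))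
    (hG' : HasMaj (BlockNorm.ofBlocks g (liftBlk (blk ∘ π) ι)) (BlockNorm.ofBlocks g (liftBlk (blk ∘ π) ι)) G₀' (fun y y' => β * Real.exp (-(δ * g.dist y y'))))
    (hD' : ∀ j, HasMaj (BlockNorm.ofBlocks g (liftBlk (blk ∘ π) ι)) (BlockNorm.ofBlocks g (liftBlk (blk ∘ π) ι)) (D' j) (fun y y' => β * Real.exp (-(δ * g.dist y y'))))
    (hDG : HasMaj (BlockNorm.ofBlocks g (liftBlk blk ι)) (BlockNorm.ofBlocks g (liftBlk (blk ∘ π) ι)) (idef (pull (liftMap π ι)) (pull (liftMap π ι)) G₀' G₀)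
      (fun y y' => mG * Real.exp (-(δ * g.dist y y'))))
    (hDD : ∀ j, HasMaj (BlockNorm.ofBlocks g (liftBlk blk ι)) (BlockNorm.ofBlocks g (liftBlk (blk ∘ π) ι)) (idef (pull (liftMap π ι)) (pull (liftMap π ι)) (D' j) (D j))
      (fun y y' => mG * Real.exp (-(δ * g.dist y y'))))
    (hV : HasMaj (BlockNorm.ofBlocks g (blkPair (liftBlk blk ι))) (BlockNorm.ofBlocks g (liftBlk blk ι)) V (fun y y' => R * Real.exp (-(δV * g.dist y y'))))
    (hV' : HasMaj (BlockNorm.ofBlocks g (blkPair (liftBlk (blk ∘ π) ι))) (BlockNorm.ofBlocks g (liftBlk (blk ∘ π) ι)) V' (fun y y' => R * Real.exp (-(δV * g.dist y y'))))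
    (hDV : HasMaj (BlockNorm.ofBlocks g (blkPair (liftBlk blk ι))) (BlockNorm.ofBlocks g (liftBlk (blk ∘ π) ι))
      (idef (pull (liftPair (liftMap π ι))) (pull (liftMap π ι)) V' V) (fun y y' => o * Real.exp (-(δV * g.dist y y'))))
    (hq : β * (R * cr) * cr < 1) :
    HasMaj (BlockNorm.ofBlocks g (liftBlk blk ι)) (BlockNorm.ofBlocks g (liftBlk (blk ∘ π) ι))
      (idef (pull (liftMap π ι)) (pull (liftMap π ι)) (projO j ∘ₗ bgPropV (stack G₀' D') V') (projO j ∘ₗ bgPropV (stack G₀ D) V))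
      (fun y y' => ind S y * ind S y' * ((mG * cr + 1 * (mG * cr) * (R * (β * (1 - β * (R * cr) * cr)⁻¹) * cr) + β * o * cr * (β * (1 - β * (R * cr) * cr)⁻¹) * cr) *
        (1 - 1 * (β * (R * cr) * cr))⁻¹ * Real.exp (-(ρ₂ * g.dist y y')))) := by
  have key := hasMaj_idef_dressedV_proj blk π htri hd hrow hσ hcr hβ hR ho hmG hσρ hρ₁V hρ₁G hρ₂ hρ₂₁ hG hD hG' hD' hDG hDD hV hV' hDV hq j
  have hq' : 0 < 1 - β * (R * cr) * cr := by linarith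
  have hK0 : ∀ a b : g.Site, 0 ≤ (mG * cr + 1 * (mG * cr) * (R * (β * (1 - β * (R * cr) * cr)⁻¹) * cr) + β * o * cr * (β * (1 - β * (R * cr) * cr)⁻¹) * cr) *
      (1 - 1 * (β * (R * cr) * cr))⁻¹ * Real.exp (-(ρ₂ * g.dist a b)) := fun a b => by
    have h1 : 0 ≤ (1 - β * (R * cr) * cr)⁻¹ := inv_nonneg.2 hq'.le
    have h2 : 0 ≤ (1 - 1 * (β * (R * cr) * cr))⁻¹ := inv_nonneg.2 (by linarith)
    positivity
  obtain ⟨hunit, -⟩ := hasMaj_dressedV_pair blk htri hd hrow hσ hβ hR hcr hσρ hρ₁V hρ₁G hρ₂ hρ₂₁ hG hD hV hq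
  obtain ⟨hunit', -⟩ := hasMaj_dressedV_pair (blk ∘ π) htri hd hrow hσ hβ hR hcr hσρ hρ₁V hρ₁G hρ₂ hρ₂₁ hG' hD' hV' hq
  obtain ⟨houtc, hinc⟩ := projO_dressedV_cutoffs hDq hunit j hψ' hGψ
  obtain ⟨houtf, hinf⟩ := projO_dressedV_cutoffs hDq' hunit' j hψ'f hGψf
  obtain ⟨hout, hin⟩ := idef_out_in blk π hSψ' hSψ hSψ'f hSψf houtc hinc houtf hinf
  exact hasMaj_localize (liftBlk blk ι) (liftBlk (blk ∘ π) ι) hK0 hout hin key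

end Components

/-! ## §2 The η-defect of the right entries (the source step with a decaying perturbation) -/

section Source

variable {X₁ X₂ X₁' X₂' : Type} [Fintype X₁] [Fintype X₂] [Fintype X₁'] [Fintype X₂'] [DecidableEq X₁] [DecidableEq X₂] [DecidableEq X₁'] [DecidableEq X₂']
  {g : B6.Geometry} (blk₁ : X₁ → g.Site) (blk₂ : X₂ → g.Site) (π₁ : X₁' → X₁) (π₂ : X₂' → X₂) {σ cr : ℝ}

omit [Fintype X₁'] [Fintype X₂'] [DecidableEq X₁'] [DecidableEq X₂'] in
/-- `V̂∘Z ≤ Rβ₂(1 − q)⁻¹c_r·e^{−ρ₂d}` for the source step `Z = bgSourceV Ĝ Ŝ V̂`, `Ŝ ≤ β₂e^{−δd}`. [cite: Balaban1985BackgroundPropagators, (3.63) p.402 (shape)] -/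
theorem hasMaj_V_bgSourceVE (htri : Triangle254 g) (hd : ∀ a b : g.Site, 0 ≤ g.dist a b) (hrow : RowSum g σ cr) (hσ : 0 ≤ σ) {ρ₁ ρ₂ δ δV β β₂ R : ℝ} (hβ : 0 ≤ β)
    (hβ₂ : 0 ≤ β₂) (hR : 0 ≤ R) (hcr : 0 ≤ cr) (hσρ : σ ≤ ρ₁) (hρ₁V : ρ₁ ≤ δV) (hρ₁G : ρ₁ + σ ≤ δ) (hρ₂ : 0 ≤ ρ₂) (hρ₂₁ : ρ₂ + σ ≤ ρ₁)
    {G S : (X₁ → ℝ) →ₗ[ℝ] (X₂ → ℝ)} {V : (X₂ → ℝ) →ₗ[ℝ] (X₁ → ℝ)}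
    (hG : HasMaj (BlockNorm.ofBlocks g blk₁) (BlockNorm.ofBlocks g blk₂) G (fun y y' => β * Real.exp (-(δ * g.dist y y'))))
    (hS : HasMaj (BlockNorm.ofBlocks g blk₁) (BlockNorm.ofBlocks g blk₂) S (fun y y' => β₂ * Real.exp (-(δ * g.dist y y'))))
    (hV : HasMaj (BlockNorm.ofBlocks g blk₂) (BlockNorm.ofBlocks g blk₁) V (fun y y' => R * Real.exp (-(δV * g.dist y y')))) (hq : β * (R * cr) * cr < 1) :
    HasMaj (BlockNorm.ofBlocks g blk₁) (BlockNorm.ofBlocks g blk₁) (V ∘ₗ bgSourceV G S V)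
      (fun y y' => R * (β₂ * (1 - β * (R * cr) * cr)⁻¹) * cr * Real.exp (-(ρ₂ * g.dist y y'))) := by
  have hZ := hasMaj_bgSourceVE blk₁ blk₂ htri hd hrow hσ hβ hβ₂ hR hcr hσρ hρ₁V hρ₁G hρ₂ hρ₂₁ hG hS hV hq
  have hβZ : 0 ≤ β₂ * (1 - β * (R * cr) * cr)⁻¹ := mul_nonneg hβ₂ (inv_nonneg.2 (by linarith))
  have hρ₂V : ρ₂ + σ ≤ δV := by linarith
  refine (hasMaj_comp_exp htri hd hrow hR hβZ hρ₂ le_rfl hρ₂V hV hZ).mono fun a b => le_of_eq ?_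
  rw [kappa_ofBlocks]; ring

/-- ★★ **THE η-DEFECT OF THE RECTANGULAR SOURCE STEP, DECAYING PERTURBATION**: `Ĝ, Ĝ′ ≤ βe^{−δd}`, `𝔇(Ĝ′, Ĝ) ≤ m_Ge^{−δd}`; source `Ŝ ≤ β₂e^{−δd}`, `𝔇(Ŝ′, Ŝ) ≤ m_Se^{−δd}`; `V̂, V̂′ ≤ Re^{−δ_Vd}`,
`𝔇(V̂′, V̂) ≤ oe^{−δ_Vd}`; `q = βRc_r² < 1`, `β₂′ = β₂(1 − q)⁻¹` ⟹ `𝔇(Z′, Z) ≤ (m_Sc_r + m_Gc_r·(Rβ₂′c_r) + βoc_r·β₂′·c_r)(1 − q)⁻¹e^{−ρ₂d}` (dag-n15-c A2 `idef_source_step_majorant`,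
flat weight). [cite: Balaban1985BackgroundPropagators, (3.42) + (3.44) p.397 (entries: shapes), (3.63)–(3.65) pp.402–403 (mechanism), Thm 3.14 pp.426–427 (template)] -/
theorem hasMaj_idef_bgSourceVE (htri : Triangle254 g) (hd : ∀ a b : g.Site, 0 ≤ g.dist a b) (hrow : RowSum g σ cr) (hσ : 0 ≤ σ) (hcr : 0 ≤ cr) {ρ₁ ρ₂ δ δV β β₂ R o mG mS : ℝ}
    (hβ : 0 ≤ β) (hβ₂ : 0 ≤ β₂) (hR : 0 ≤ R) (ho : 0 ≤ o) (hmG : 0 ≤ mG) (hmS : 0 ≤ mS) (hσρ : σ ≤ ρ₁) (hρ₁V : ρ₁ ≤ δV) (hρ₁G : ρ₁ + σ ≤ δ) (hρ₂ : 0 ≤ ρ₂)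
    (hρ₂₁ : ρ₂ + σ ≤ ρ₁) {G S : (X₁ → ℝ) →ₗ[ℝ] (X₂ → ℝ)} {V : (X₂ → ℝ) →ₗ[ℝ] (X₁ → ℝ)} {G' S' : (X₁' → ℝ) →ₗ[ℝ] (X₂' → ℝ)} {V' : (X₂' → ℝ) →ₗ[ℝ] (X₁' → ℝ)}
    (hG : HasMaj (BlockNorm.ofBlocks g blk₁) (BlockNorm.ofBlocks g blk₂) G (fun y y' => β * Real.exp (-(δ * g.dist y y'))))
    (hG' : HasMaj (BlockNorm.ofBlocks g (blk₁ ∘ π₁)) (BlockNorm.ofBlocks g (blk₂ ∘ π₂)) G' (fun y y' => β * Real.exp (-(δ * g.dist y y'))))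
    (hS : HasMaj (BlockNorm.ofBlocks g blk₁) (BlockNorm.ofBlocks g blk₂) S (fun y y' => β₂ * Real.exp (-(δ * g.dist y y'))))
    (hDG : HasMaj (BlockNorm.ofBlocks g blk₁) (BlockNorm.ofBlocks g (blk₂ ∘ π₂)) (idef (pull π₁) (pull π₂) G' G) (fun y y' => mG * Real.exp (-(δ * g.dist y y'))))
    (hDS : HasMaj (BlockNorm.ofBlocks g blk₁) (BlockNorm.ofBlocks g (blk₂ ∘ π₂)) (idef (pull π₁) (pull π₂) S' S) (fun y y' => mS * Real.exp (-(δ * g.dist y y'))))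
    (hV : HasMaj (BlockNorm.ofBlocks g blk₂) (BlockNorm.ofBlocks g blk₁) V (fun y y' => R * Real.exp (-(δV * g.dist y y'))))
    (hV' : HasMaj (BlockNorm.ofBlocks g (blk₂ ∘ π₂)) (BlockNorm.ofBlocks g (blk₁ ∘ π₁)) V' (fun y y' => R * Real.exp (-(δV * g.dist y y'))))
    (hDV : HasMaj (BlockNorm.ofBlocks g blk₂) (BlockNorm.ofBlocks g (blk₁ ∘ π₁)) (idef (pull π₂) (pull π₁) V' V) (fun y y' => o * Real.exp (-(δV * g.dist y y'))))
    (hq : β * (R * cr) * cr < 1) :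
    HasMaj (BlockNorm.ofBlocks g blk₁) (BlockNorm.ofBlocks g (blk₂ ∘ π₂)) (idef (pull π₁) (pull π₂) (bgSourceV G' S' V') (bgSourceV G S V))
      (fun y y' => (mS * cr + 1 * (mG * cr) * (R * (β₂ * (1 - β * (R * cr) * cr)⁻¹) * cr) * 1 + β * o * cr * (β₂ * (1 - β * (R * cr) * cr)⁻¹) * cr) *
        (1 - 1 * (β * (R * cr) * cr))⁻¹ * Real.exp (-(ρ₂ * g.dist y y')) * 1) := by
  have hρ₁ : 0 ≤ ρ₁ := hσ.trans hσρ
  have hq' : 0 < 1 - β * (R * cr) * cr := by linarith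
  have hAZ : 0 ≤ β₂ * (1 - β * (R * cr) * cr)⁻¹ := mul_nonneg hβ₂ (inv_nonneg.2 hq'.le)
  have hfix := bgSourceV_fix (S := S) (isUnit_stepVE blk₁ blk₂ htri hd hrow hσ hβ hR hcr hσρ hρ₁V hρ₁G hG hV hq)
  have hfix' := bgSourceV_fix (S := S') (isUnit_stepVE (blk₁ ∘ π₁) (blk₂ ∘ π₂) htri hd hrow hσ hβ hR hcr hσρ hρ₁V hρ₁G hG' hV' hq)
  have hK' : HasMaj (BlockNorm.ofBlocks g (blk₂ ∘ π₂)) (BlockNorm.ofBlocks g (blk₂ ∘ π₂)) (G' ∘ₗ V') (fun y y' => β * (R * cr) * Real.exp (-(ρ₁ * g.dist y y'))) :=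
    (hasMaj_stepVE (blk₁ ∘ π₁) (blk₂ ∘ π₂) htri hd hrow hβ hR hρ₁ hρ₁V hρ₁G hG' hV').mono fun a b => le_of_eq (by ring)
  have hwrow' : WRow g ρ₂ (fun y y' => β * (R * cr) * Real.exp (-(ρ₁ * g.dist y y'))) (β * (R * cr) * cr) :=
    wrow_of_exp hd hrow (mul_nonneg hβ (mul_nonneg hR hcr)) hρ₂₁
  have hwrowG : WRow g ρ₂ (fun y y' => mG * Real.exp (-(δ * g.dist y y'))) (mG * cr) := wrow_of_exp hd hrow hmG (by linarith)
  have hwrowS : WRow g ρ₂ (fun y y' => mS * Real.exp (-(δ * g.dist y y'))) (mS * cr) := wrow_of_exp hd hrow hmS (by linarith)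
  have hVX := hasMaj_V_bgSourceVE blk₁ blk₂ htri hd hrow hσ hβ hβ₂ hR hcr hσρ hρ₁V hρ₁G hρ₂ hρ₂₁ hG hS hV hq
  have hZ := hasMaj_bgSourceVE blk₁ blk₂ htri hd hrow hσ hβ hβ₂ hR hcr hσρ hρ₁V hρ₁G hρ₂ hρ₂₁ hG hS hV hq
  have hDVs := hasMaj_sandwichVE blk₁ blk₂ π₁ π₂ htri hd hrow hσ hβ hAZ ho hcr hσρ hρ₁V hρ₁G hρ₂ hρ₂₁ hG' hZ hDV
  obtain ⟨M₀, hM₀, hap⟩ := exists_const_hasMaj_ofBlocks (g := g) blk₁ (blk₂ ∘ π₂) (idef (pull π₁) (pull π₂) (bgSourceV G' S' V') (bgSourceV G S V))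
  have hq2 : (BlockNorm.ofBlocks g (blk₂ ∘ π₂)).κ * (β * (R * cr) * cr) < 1 := by rw [kappa_ofBlocks, one_mul]; exact hq
  have hAV : 0 ≤ R * (β₂ * (1 - β * (R * cr) * cr)⁻¹) * cr := mul_nonneg (mul_nonneg hR hAZ) hcr
  have hcV : 0 ≤ β * o * cr * (β₂ * (1 - β * (R * cr) * cr)⁻¹) * cr := mul_nonneg (mul_nonneg (mul_nonneg (mul_nonneg hβ ho) hcr) hAZ) hcr
  have key := idef_source_step_majorant (b₁ := BlockNorm.ofBlocks g blk₁) (b₂' := BlockNorm.ofBlocks g (blk₂ ∘ π₂)) (τ₁ := pull π₁) (τ₂ := pull π₂) (S := S) (G₁ := G)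
    (Xc := bgSourceV G S V) (V := V) (S' := S') (G₁' := G') (Xf := bgSourceV G' S' V') (V' := V') (w := fun _ => (1 : ℝ)) (ρ := ρ₂) (σ := 0) (C := 1) htri hd hρ₂
    (fun _ => zero_le_one) (slowWeight_const 1) zero_le_one hAV hcV hM₀ (fun _ _ => mul_nonneg (mul_nonneg hβ (mul_nonneg hR hcr)) (Real.exp_nonneg _)) hwrow'
    (fun _ _ => mul_nonneg hmS (Real.exp_nonneg _)) hwrowS (fun _ _ => mul_nonneg hmG (Real.exp_nonneg _)) hwrowG hfix hfix' hK' (by simpa only [add_zero] using hVX)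
    (by simpa only [mul_one] using hDS) (by simpa only [mul_one] using hDG) (by simpa only [mul_one] using hDVs) (by simpa only [mul_one] using hap) hq2
  refine key.mono fun a b => le_of_eq ?_
  rfl

end Source

section RightEntries

variable {X X' ι J : Type} [Fintype X] [Fintype X'] [DecidableEq X] [DecidableEq X'] [Fintype ι] [DecidableEq ι] [Fintype J] [DecidableEq J] {g : B6.Geometry}
  (blk : X → g.Site) (π : X' → X) {σ cr : ℝ} {G₀ : (X × ι → ℝ) →ₗ[ℝ] (X × ι → ℝ)} {D : J ⊕ J → (X × ι → ℝ) →ₗ[ℝ] (X × ι → ℝ)}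
  {V : ((X × ι) × Option (J ⊕ J) → ℝ) →ₗ[ℝ] (X × ι → ℝ)} {G₀' : (X' × ι → ℝ) →ₗ[ℝ] (X' × ι → ℝ)} {D' : J ⊕ J → (X' × ι → ℝ) →ₗ[ℝ] (X' × ι → ℝ)}
  {V' : ((X' × ι) × Option (J ⊕ J) → ℝ) →ₗ[ℝ] (X' × ι → ℝ)}

/-- ★★ **THE η-DEFECT OF THE RIGHT ENTRIES OF THE DRESSED CUBE PAIR** (FILE 55's `hIGE` shape, unlocalized): `X̂∘Q = bgSourceV Ŝ (Ŝ∘Q) V̂` at both grids, so from the flat right entries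
`G₀Q, D_jQ ≤ β₂e^{−δd}` and their defects `𝔇(G₀′Q′, G₀Q), 𝔇(D′_jQ′, D_jQ) ≤ m_Qe^{−δd}` (plus the pair's data): `𝔇(X̂′Q′, X̂Q) ≤ (…)(1 − q)⁻¹e^{−ρ₂d}`.
[cite: Balaban1985BackgroundPropagators, (3.42) p.397 (entry 2: shape), (3.63)–(3.65) pp.402–403, Thm 3.14 pp.426–427 (template)] -/
theorem hasMaj_idef_dressedV_comp (htri : Triangle254 g) (hd : ∀ a b : g.Site, 0 ≤ g.dist a b) (hrow : RowSum g σ cr) (hσ : 0 ≤ σ) (hcr : 0 ≤ cr)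
    {ρ₁ ρ₂ δ δV β β₂ R o mG mQ : ℝ} (hβ : 0 ≤ β) (hβ₂ : 0 ≤ β₂) (hR : 0 ≤ R) (ho : 0 ≤ o) (hmG : 0 ≤ mG) (hmQ : 0 ≤ mQ) (hσρ : σ ≤ ρ₁) (hρ₁V : ρ₁ ≤ δV)
    (hρ₁G : ρ₁ + σ ≤ δ) (hρ₂ : 0 ≤ ρ₂) (hρ₂₁ : ρ₂ + σ ≤ ρ₁) (Q : (X × ι → ℝ) →ₗ[ℝ] (X × ι → ℝ)) (Q' : (X' × ι → ℝ) →ₗ[ℝ] (X' × ι → ℝ))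
    (hG : HasMaj (BlockNorm.ofBlocks g (liftBlk blk ι)) (BlockNorm.ofBlocks g (liftBlk blk ι)) G₀ (fun y y' => β * Real.exp (-(δ * g.dist y y'))))
    (hD : ∀ j, HasMaj (BlockNorm.ofBlocks g (liftBlk blk ι)) (BlockNorm.ofBlocks g (liftBlk blk ι)) (D j) (fun y y' => β * Real.exp (-(δ * g.dist y y'))))
    (hG' : HasMaj (BlockNorm.ofBlocks g (liftBlk (blk ∘ π) ι)) (BlockNorm.ofBlocks g (liftBlk (blk ∘ π) ι)) G₀' (fun y y' => β * Real.exp (-(δ * g.dist y y'))))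
    (hD' : ∀ j, HasMaj (BlockNorm.ofBlocks g (liftBlk (blk ∘ π) ι)) (BlockNorm.ofBlocks g (liftBlk (blk ∘ π) ι)) (D' j) (fun y y' => β * Real.exp (-(δ * g.dist y y'))))
    (hDG : HasMaj (BlockNorm.ofBlocks g (liftBlk blk ι)) (BlockNorm.ofBlocks g (liftBlk (blk ∘ π) ι)) (idef (pull (liftMap π ι)) (pull (liftMap π ι)) G₀' G₀)
      (fun y y' => mG * Real.exp (-(δ * g.dist y y'))))
    (hDD : ∀ j, HasMaj (BlockNorm.ofBlocks g (liftBlk blk ι)) (BlockNorm.ofBlocks g (liftBlk (blk ∘ π) ι)) (idef (pull (liftMap π ι)) (pull (liftMap π ι)) (D' j) (D j))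
      (fun y y' => mG * Real.exp (-(δ * g.dist y y'))))
    (hGQ : HasMaj (BlockNorm.ofBlocks g (liftBlk blk ι)) (BlockNorm.ofBlocks g (liftBlk blk ι)) (G₀ ∘ₗ Q) (fun y y' => β₂ * Real.exp (-(δ * g.dist y y'))))
    (hDQ : ∀ j, HasMaj (BlockNorm.ofBlocks g (liftBlk blk ι)) (BlockNorm.ofBlocks g (liftBlk blk ι)) (D j ∘ₗ Q) (fun y y' => β₂ * Real.exp (-(δ * g.dist y y'))))
    (hDGQ : HasMaj (BlockNorm.ofBlocks g (liftBlk blk ι)) (BlockNorm.ofBlocks g (liftBlk (blk ∘ π) ι))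
      (idef (pull (liftMap π ι)) (pull (liftMap π ι)) (G₀' ∘ₗ Q') (G₀ ∘ₗ Q)) (fun y y' => mQ * Real.exp (-(δ * g.dist y y'))))
    (hDDQ : ∀ j, HasMaj (BlockNorm.ofBlocks g (liftBlk blk ι)) (BlockNorm.ofBlocks g (liftBlk (blk ∘ π) ι))
      (idef (pull (liftMap π ι)) (pull (liftMap π ι)) (D' j ∘ₗ Q') (D j ∘ₗ Q)) (fun y y' => mQ * Real.exp (-(δ * g.dist y y'))))
    (hV : HasMaj (BlockNorm.ofBlocks g (blkPair (liftBlk blk ι))) (BlockNorm.ofBlocks g (liftBlk blk ι)) V (fun y y' => R * Real.exp (-(δV * g.dist y y'))))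
    (hV' : HasMaj (BlockNorm.ofBlocks g (blkPair (liftBlk (blk ∘ π) ι))) (BlockNorm.ofBlocks g (liftBlk (blk ∘ π) ι)) V' (fun y y' => R * Real.exp (-(δV * g.dist y y'))))
    (hDV : HasMaj (BlockNorm.ofBlocks g (blkPair (liftBlk blk ι))) (BlockNorm.ofBlocks g (liftBlk (blk ∘ π) ι))
      (idef (pull (liftPair (liftMap π ι))) (pull (liftMap π ι)) V' V) (fun y y' => o * Real.exp (-(δV * g.dist y y'))))
    (hq : β * (R * cr) * cr < 1) :
    HasMaj (BlockNorm.ofBlocks g (liftBlk blk ι)) (BlockNorm.ofBlocks g (blkPair (liftBlk (blk ∘ π) ι)))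
      (idef (pull (liftMap π ι)) (pull (liftPair (liftMap π ι))) (bgPropV (stack G₀' D') V' ∘ₗ Q') (bgPropV (stack G₀ D) V ∘ₗ Q))
      (fun y y' => (mQ * cr + 1 * (mG * cr) * (R * (β₂ * (1 - β * (R * cr) * cr)⁻¹) * cr) * 1 + β * o * cr * (β₂ * (1 - β * (R * cr) * cr)⁻¹) * cr) *
        (1 - 1 * (β * (R * cr) * cr))⁻¹ * Real.exp (-(ρ₂ * g.dist y y')) * 1) := by
  have hβe : ∀ y y' : g.Site, 0 ≤ β * Real.exp (-(δ * g.dist y y')) := fun _ _ => mul_nonneg hβ (Real.exp_nonneg _)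
  have hβ₂e : ∀ y y' : g.Site, 0 ≤ β₂ * Real.exp (-(δ * g.dist y y')) := fun _ _ => mul_nonneg hβ₂ (Real.exp_nonneg _)
  have hme : ∀ y y' : g.Site, 0 ≤ mG * Real.exp (-(δ * g.dist y y')) := fun _ _ => mul_nonneg hmG (Real.exp_nonneg _)
  have hmQe : ∀ y y' : g.Site, 0 ≤ mQ * Real.exp (-(δ * g.dist y y')) := fun _ _ => mul_nonneg hmQ (Real.exp_nonneg _)
  have hst : stack G₀ D ∘ₗ Q = stack (G₀ ∘ₗ Q) (fun j => D j ∘ₗ Q) := LinearMap.ext fun v => funext fun p => by rcases p with ⟨y, _ | j⟩ <;> rfl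
  have hst' : stack G₀' D' ∘ₗ Q' = stack (G₀' ∘ₗ Q') (fun j => D' j ∘ₗ Q') := LinearMap.ext fun v => funext fun p => by rcases p with ⟨y, _ | j⟩ <;> rfl
  have hSG := hasMaj_stack (liftBlk blk ι) hβe hG hD
  have hSG' := hasMaj_stack (liftBlk (blk ∘ π) ι) hβe hG' hD'
  have hSQ : HasMaj (BlockNorm.ofBlocks g (liftBlk blk ι)) (BlockNorm.ofBlocks g (blkPair (liftBlk blk ι))) (stack G₀ D ∘ₗ Q) (fun y y' => β₂ * Real.exp (-(δ * g.dist y y'))) := by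
    rw [hst]; exact hasMaj_stack (liftBlk blk ι) hβ₂e hGQ hDQ
  have hSD : HasMaj (BlockNorm.ofBlocks g (liftBlk blk ι)) (BlockNorm.ofBlocks g (blkPair (liftBlk (blk ∘ π) ι)))
      (idef (pull (liftMap π ι)) (pull (liftPair (liftMap π ι))) (stack G₀' D') (stack G₀ D)) (fun y y' => mG * Real.exp (-(δ * g.dist y y'))) := by
    rw [idef_stack]; exact hasMaj_stack (liftBlk (blk ∘ π) ι) hme hDG hDD
  have hSDQ : HasMaj (BlockNorm.ofBlocks g (liftBlk blk ι)) (BlockNorm.ofBlocks g (blkPair (liftBlk (blk ∘ π) ι)))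
      (idef (pull (liftMap π ι)) (pull (liftPair (liftMap π ι))) (stack G₀' D' ∘ₗ Q') (stack G₀ D ∘ₗ Q)) (fun y y' => mQ * Real.exp (-(δ * g.dist y y'))) := by
    rw [hst, hst', idef_stack]; exact hasMaj_stack (liftBlk (blk ∘ π) ι) hmQe hDGQ hDDQ
  rw [bgPropV_comp, bgPropV_comp]
  exact hasMaj_idef_bgSourceVE (liftBlk blk ι) (blkPair (liftBlk blk ι)) (liftMap π ι) (liftPair (liftMap π ι)) htri hd hrow hσ hcr hβ hβ₂ hR ho hmG hmQ hσρ hρ₁V hρ₁G hρ₂ hρ₂₁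
    hSG hSG' hSQ hSD hSDQ hV hV' hDV hq

end RightEntries

end Summit.QuantumFields.YangMills.BalabanUVNodes.N15.CurvedSpecies

end
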